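import Literature.Algebra.Homology.ContCohomologyInflation
import HarnessLib

/-!
# Degree-one inflation: the hypothesis schema `CrossedHomsKillKer φ X` (FACT-LIST F-2284) has a
# REFUTABLE universal closure — it is a HYPOTHESIS verified at named instances, not a fact

J.-P. Serre, *Galois Cohomology*, I §2.6 (b) (the degree-one inflation statement)
[cite: SerreGaloisCohomology1997, I §2.6 (b)].

Negative knowledge recorded next to `ContCohomologyInflation.lean` (abc-iut-L4-t16), PROOF-ONLY (no
definition, no instance), abc-iut cell seat abc-iut-f-007 (block F, FACT-LIST row **F-2284**
`ContinuousCohomology.CrossedHomsKillKer`; class `classical/other`, kernel_closedness `parametrised`).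

`CrossedHomsKillKer φ X := ∀ f : C(H, X), (∀ a b, f (a b) = f a + φ(a) • f b) → ∀ n, φ n = 1 → f n = 0`
("every continuous crossed homomorphism `H → X` for the action through `φ : H → G` vanishes on `Ker φ`")
is THE HYPOTHESIS under which `isIso_map_one_of_crossedHomsKillKer` proves that inflation
`H¹(G, X) → H¹(H, X|_H)` is an isomorphism; its docstring says so ("THE HYPOTHESIS of the degree-one
inflation theorem").  It binds `φ` and `X` as free parameters, and its universal closure is false —
a crossed homomorphism need not kill the kernel.  This file supplies the smallest kernel object: for the
trivial homomorphism `φ = 1 : ℤ → ℤ` (multiplicative copies of `ℤ`, discrete) and the trivial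
`ℤ[ℤ]`-module `X = ℤ`, the identity `ℤ → ℤ` is a continuous crossed (= ordinary) homomorphism that does
not vanish on `Ker φ = ℤ`:

* `not_crossedHomsKillKer_one_int` — the named instance;
* `not_forall_crossedHomsKillKer` — the fully quantified closure (at universe level `0`) is FALSE.

The INSTANCE forms consumers bind are PROVED in the tree: `AbsCusp.crossedHomsKillKer_piAb`,
`AbsCusp.crossedHomsKillKer_piCn` (`AbsCuspCohomologyProofs.lean`, abc-iut-L4: the surjections
`Π_{U_S} ↠ Π^{c-ab}_{U_S} ↠ Π^{c-cn}_{U_S}` of [AbsCusp] Prop. 2.1 (i), where `Δ_{U_S}` acts trivially on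
`M_X`), feeding `AbsCusp.prop_2_1_i_holds`.  So the row is admissible ONLY in its instance form
(FACT-LIST class «universal-closure REFUTED; instance form PROVED»).  Elementary; nothing here bears on
the disputed [IUTchIII] Cor. 3.12 or takes a side.
-/

namespace ContinuousCohomology

open ContRepresentation

/-- **F-2284, universal closure false at a named instance:** for `φ = 1 : ℤ → ℤ` (written
multiplicatively) and the trivial topological `ℤ[ℤ]`-module `ℤ`, the identity is a continuous crossed
homomorphism `ℤ → ℤ` with `f 1 = 1 ≠ 0` although `φ 1 = 1`, i.e. `¬ CrossedHomsKillKer 1 ℤ`.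
[cite: SerreGaloisCohomology1997, I §2.6 (b)] -/
theorem not_crossedHomsKillKer_one_int :
    ¬ CrossedHomsKillKer.{0, 0, 0} (k := ℤ) (1 : Multiplicative ℤ →ₜ* Multiplicative ℤ)
        (TopRep.of (ContRepresentation.trivial ℤ (Multiplicative ℤ) ℤ)) := by
  intro h
  have key := h ⟨fun x => Multiplicative.toAdd x, continuous_of_discreteTopology⟩
    (fun a b => by
      change Multiplicative.toAdd (a * b) =
        Multiplicative.toAdd a +
          ContRepresentation.trivial ℤ (Multiplicative ℤ) ℤ
            ((1 : Multiplicative ℤ →ₜ* Multiplicative ℤ) a) (Multiplicative.toAdd b)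
      rw [ContRepresentation.trivial_apply, toAdd_mul])
    (Multiplicative.ofAdd 1) rfl
  exact one_ne_zero (α := ℤ) key

/-- **F-2284 as a schema is not a fact:** the fully quantified closure of
`ContinuousCohomology.CrossedHomsKillKer` (over all coefficient rings, topological groups, continuous
homomorphisms `φ` and topological modules `X`, at universe level `0`) is FALSE; the predicate is a
hypothesis, discharged in the tree at the instances `AbsCusp.crossedHomsKillKer_piAb` /
`AbsCusp.crossedHomsKillKer_piCn`. [cite: SerreGaloisCohomology1997, I §2.6 (b)] -/
theorem not_forall_crossedHomsKillKer :
    ¬ ∀ {k : Type} [Ring k] [TopologicalSpace k] {G H : Type} [Group G] [TopologicalSpace G]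
        [Group H] [TopologicalSpace H] (φ : H →ₜ* G) (X : TopRep.{0} k G),
        CrossedHomsKillKer.{0, 0, 0} φ X :=
  fun h => not_crossedHomsKillKer_one_int (h _ _)

end ContinuousCohomology
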